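import Literature.NumberTheory.EllipticCurves.IwasawaTwistModPDual
import Mathlib.RingTheory.PowerSeries.Inverse
import HarnessLib

/-!
# K6 crux `MuTransferX9` (stmt-BirchSwinnertonDyer-19276), MU-TRANSFER-PROOF §5 STEP 4 → `hq`: the
# TRIANGULAR PACKAGING — if every member `Φ_k = Σ_{j ≤ k} u_j · c_{k−j}` (`k < J`) of a family with UNIT
# leading multiplier `u_0` vanishes, then every `c_k` (`k < J`) vanishes; power-series form
# `X^J ∣ U · P ⟹ X^J ∣ P` for a unit `U`

Cell `b2b-bsdres`, unit `b2b-bsdres-x10` (N2 = X10b at `p = 3` class lead, GEN 38; G4 = STEP 4 of the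
assembler's cut of `stub_coreX9`, crux 19276, cell `bsd-smallim`). HONEST FRAMING: pure algebra TOOL
theorems; no definition, no named fact, no `sorry`; nothing booked. `--supports stmt-BirchSwinnertonDyer-19276`
(helper; closes nothing). PARTITION (D-0054): X9 (A4) · X10b (A5) — prime-free algebra.

STEP 4 gives «every member of the coefficient family `Φ_k(κ_q, T^ε ψ)` vanishes» (x10
`…X9StepFourReciprocity{,Twist,Seams}`); Lemma 1 (iii) (koly, `…X9LocalQTerm`) identifies
`Φ_k = Σ_{j ≤ k} u_j · C_{k−j}(κ_q(σ̄), c_y(Fr))` with `u_0 ≠ 0` (`u(T) ∈ A_J^×`); the lemmas below turn the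
two into «`C_k(κ_q(σ̄), c_y(Fr)) = 0` for all `k < J`», i.e. `X^J ∣ Σ_k C_k X^k` — the divisibility shape of
the hypothesis `hq` of `LevelE.theoremA_contradiction_schema` (`X^(2e) ∣ X^ε·U·X^(e+a)·pair k1 cy`).

* `eq_zero_of_forall_sum_range_mul_eq_zero` — `IsUnit (u 0)`, `∀ k < J, Σ_{j ∈ range (k+1)} u j * c (k - j) = 0`
  ⟹ `∀ k < J, c k = 0` (strong induction); `…_antidiagonal_…` — the same with `Σ_{(i,j) ∈ antidiagonal k} u i * c j`
  (the shape of `PowerSeries.coeff_mul`);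
* `X_pow_dvd_of_X_pow_dvd_mul_of_isUnit` — in `R⟦X⟧`, `IsUnit (constantCoeff U)` and `X^J ∣ U * P` ⟹ `X^J ∣ P`;
  `X_pow_dvd_iff_forall_coeff_mul_eq_zero` — `X^J ∣ P ↔ ∀ k < J, coeff k (U * P) = 0` for such `U`;
* the GENERATING SERIES `Σ_k ι(C_k(x, y)) X^k ∈ R⟦X⟧` of k6-ty's convolution coefficients
  (`convCoeff e J k`, file `IwasawaTwistModPDual`; `ι : P →+ R` a trivialisation of the values, e.g.
  `μ_p ≃ ℤ/p`) is `A_J`-BILINEAR modulo `X^J`: `X^J ∣ Σ_k ι(C_k(S^m x, y)) X^k − X^m · Σ_k ι(C_k(x, y)) X^k`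
  (`X_pow_dvd_mk_convCoeff_shiftEnd_pow_left_sub`, and `…_right_…`) — MU-TRANSFER-PROOF (F7) «`⟨·,·⟩_{A_J}`
  is `A_J`-bilinear» in the divisibility currency of `hq` (so `pair (T^{e+a} k₁) (T^ε c_y) ≡ X^{e+a+ε} · pair k₁ c_y`);
  and `mk_convCoeff_eq_zero_iff`-type bookkeeping: `X^J ∣ Σ_k ι(C_k(x, y)) X^k ↔ ∀ k < J, ι(C_k(x, y)) = 0`.

References: HOME pub/bsd-smallim/koly/MU-TRANSFER-PROOF.md §5 STEP 4, (F7); KOLY-MEMO v1.8.7 §5.11.B (N5);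
B. Mazur, K. Rubin, Mem. AMS 799 (2004) §4.4 (prototype of the count) [MazurRubin2004].
-/

set_option autoImplicit false

namespace Summit.BirchSwinnertonDyer.BirchSwinnertonDyer.Rank1Residual.StepFour

-- the summit and its single problem are both named `BirchSwinnertonDyer` (registry layout D-0017)
set_option linter.dupNamespace false

open Finset PowerSeries

variable {R : Type*} [CommRing R]

/-- **Triangular packaging (range form).** If `u 0` is a unit and `Σ_{j ≤ k} u j · c (k − j) = 0` for all
`k < J`, then `c k = 0` for all `k < J`. [cite: MazurRubin2004, §4.4] -/
theorem eq_zero_of_forall_sum_range_mul_eq_zero {u c : ℕ → R} (hu : IsUnit (u 0)) {J : ℕ}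
    (h : ∀ k < J, ∑ j ∈ range (k + 1), u j * c (k - j) = 0) : ∀ k < J, c k = 0 := by
  intro k
  induction k using Nat.strong_induction_on with
  | _ k ih =>
    intro hk
    have hsum := h k hk
    rw [sum_range_succ', Nat.sub_zero] at hsum
    have hrest : ∑ j ∈ range k, u (j + 1) * c (k - (j + 1)) = 0 :=
      sum_eq_zero fun j hj => by
        rw [ih (k - (j + 1)) (by have := mem_range.1 hj; omega) (by omega), mul_zero]
    rw [hrest, zero_add] at hsum
    obtain ⟨v, hv⟩ := hu
    have := congrArg (fun t => (↑v⁻¹ : R) * t) hsum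
    simpa [← hv, ← mul_assoc] using this

/-- **Triangular packaging (antidiagonal form**, the shape of `PowerSeries.coeff_mul`). If `u 0` is a unit
and `Σ_{(i,j) ∈ antidiagonal k} u i · c j = 0` for all `k < J`, then `c k = 0` for all `k < J`.
[cite: MazurRubin2004, §4.4] -/
theorem eq_zero_of_forall_sum_antidiagonal_mul_eq_zero {u c : ℕ → R} (hu : IsUnit (u 0)) {J : ℕ}
    (h : ∀ k < J, ∑ ij ∈ antidiagonal k, u ij.1 * c ij.2 = 0) : ∀ k < J, c k = 0 := by
  refine eq_zero_of_forall_sum_range_mul_eq_zero hu fun k hk => ?_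
  rw [← h k hk, Nat.sum_antidiagonal_eq_sum_range_succ_mk]

/-- **`X^J ∣ U · P ⟹ X^J ∣ P` for a power series `U` with unit constant coefficient** (`U` is then a unit
of `R⟦X⟧`). The unit `u_q(T)` of Lemma 1 (iii) / the unit `U` of the Kolyvagin class are absorbed this way
in `hq`. [cite: MazurRubin2004, §4.4] -/
theorem X_pow_dvd_of_X_pow_dvd_mul_of_isUnit {U P : R⟦X⟧} (hU : IsUnit (constantCoeff U)) {J : ℕ}
    (h : (X : R⟦X⟧) ^ J ∣ U * P) : (X : R⟦X⟧) ^ J ∣ P := by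
  have hU' : IsUnit U := PowerSeries.isUnit_iff_constantCoeff.2 hU
  obtain ⟨V, hV⟩ := hU'
  rw [← hV] at h
  exact Units.dvd_mul_left.1 h

/-- **Coefficient form**: for `U` with unit constant coefficient, `X^J ∣ P` iff every coefficient of
`U · P` below `J` vanishes (`PowerSeries.X_pow_dvd_iff`). [cite: MazurRubin2004, §4.4] -/
theorem X_pow_dvd_iff_forall_coeff_mul_eq_zero {U P : R⟦X⟧} (hU : IsUnit (constantCoeff U)) (J : ℕ) :
    (X : R⟦X⟧) ^ J ∣ P ↔ ∀ k < J, coeff k (U * P) = 0 := by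
  rw [← PowerSeries.X_pow_dvd_iff]
  exact ⟨fun h => Dvd.dvd.mul_left h U, X_pow_dvd_of_X_pow_dvd_mul_of_isUnit hU⟩

/-! ### The generating series of the convolution coefficients is `A_J`-bilinear modulo `X^J` -/

section GeneratingSeries

open Literature.NumberTheory.EllipticCurves

variable {M M' P : Type*} [AddCommGroup M] [AddCommGroup M'] [AddCommGroup P] (e : M →+ M' →+ P)
  {J : ℕ} (ι : P →+ R)

/-- `X^J ∣ Σ_k f_k X^k` iff the coefficients below `J` vanish (`PowerSeries.X_pow_dvd_iff` for `mk`).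
[cite: MazurRubin2004, §4.4] -/
theorem X_pow_dvd_mk_iff (f : ℕ → R) : (X : R⟦X⟧) ^ J ∣ PowerSeries.mk f ↔ ∀ k < J, f k = 0 := by
  rw [PowerSeries.X_pow_dvd_iff]
  simp only [coeff_mk]

/-- **The shift multiplies the generating series by `X` modulo `X^J`** (left variable):
`X^J ∣ Σ_k ι(C_k(S x, y)) X^k − X · Σ_k ι(C_k(x, y)) X^k` (k6-ty `convCoeff_{zero,succ}_shiftEnd_left`).
[cite: MazurRubin2004, §1.3 and §5.3] -/
theorem X_pow_dvd_mk_convCoeff_shiftEnd_left_sub (x : Fin J → M) (y : Fin J → M') :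
    (X : R⟦X⟧) ^ J ∣ PowerSeries.mk (fun k => ι (convCoeff e J k (shiftEnd M J x) y)) -
      X * PowerSeries.mk (fun k => ι (convCoeff e J k x y)) := by
  rw [PowerSeries.X_pow_dvd_iff]
  intro m hm
  rw [map_sub, coeff_mk]
  cases m with
  | zero => rw [coeff_zero_X_mul, convCoeff_zero_shiftEnd_left, map_zero, sub_zero]
  | succ k => rw [coeff_succ_X_mul, coeff_mk, convCoeff_succ_shiftEnd_left e hm, sub_self]

/-- **The shift multiplies the generating series by `X` modulo `X^J`** (right variable).
[cite: MazurRubin2004, §1.3 and §5.3] -/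
theorem X_pow_dvd_mk_convCoeff_shiftEnd_right_sub (x : Fin J → M) (y : Fin J → M') :
    (X : R⟦X⟧) ^ J ∣ PowerSeries.mk (fun k => ι (convCoeff e J k x (shiftEnd M' J y))) -
      X * PowerSeries.mk (fun k => ι (convCoeff e J k x y)) := by
  rw [PowerSeries.X_pow_dvd_iff]
  intro m hm
  rw [map_sub, coeff_mk]
  cases m with
  | zero => rw [coeff_zero_X_mul, convCoeff_zero_shiftEnd_right, map_zero, sub_zero]
  | succ k => rw [coeff_succ_X_mul, coeff_mk, convCoeff_succ_shiftEnd_right e hm, sub_self]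

/-- **`T^m` multiplies the generating series by `X^m` modulo `X^J`** (left variable): MU-TRANSFER-PROOF
(F7) «`⟨·,·⟩_{A_J}` is `A_J`-bilinear», divisibility currency. [cite: MazurRubin2004, §1.3 and §5.3] -/
theorem X_pow_dvd_mk_convCoeff_shiftEnd_pow_left_sub (m : ℕ) (x : Fin J → M) (y : Fin J → M') :
    (X : R⟦X⟧) ^ J ∣ PowerSeries.mk (fun k => ι (convCoeff e J k ((shiftEnd M J ^ m) x) y)) -
      X ^ m * PowerSeries.mk (fun k => ι (convCoeff e J k x y)) := by
  induction m with
  | zero => simp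
  | succ m ih =>
    have h1 := X_pow_dvd_mk_convCoeff_shiftEnd_left_sub e ι ((shiftEnd M J ^ m) x) y
    have h2 : (X : R⟦X⟧) ^ J ∣ X * (PowerSeries.mk (fun k => ι (convCoeff e J k ((shiftEnd M J ^ m) x) y)) -
        X ^ m * PowerSeries.mk (fun k => ι (convCoeff e J k x y))) := Dvd.dvd.mul_left ih X
    have h12 := dvd_add h1 h2
    rw [pow_succ', Module.End.mul_apply]
    convert h12 using 1
    ring

/-- **`T^m` multiplies the generating series by `X^m` modulo `X^J`** (right variable).
[cite: MazurRubin2004, §1.3 and §5.3] -/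
theorem X_pow_dvd_mk_convCoeff_shiftEnd_pow_right_sub (m : ℕ) (x : Fin J → M) (y : Fin J → M') :
    (X : R⟦X⟧) ^ J ∣ PowerSeries.mk (fun k => ι (convCoeff e J k x ((shiftEnd M' J ^ m) y))) -
      X ^ m * PowerSeries.mk (fun k => ι (convCoeff e J k x y)) := by
  induction m with
  | zero => simp
  | succ m ih =>
    have h1 := X_pow_dvd_mk_convCoeff_shiftEnd_right_sub e ι x ((shiftEnd M' J ^ m) y)
    have h2 : (X : R⟦X⟧) ^ J ∣ X * (PowerSeries.mk (fun k => ι (convCoeff e J k x ((shiftEnd M' J ^ m) y))) -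
        X ^ m * PowerSeries.mk (fun k => ι (convCoeff e J k x y))) := Dvd.dvd.mul_left ih X
    have h12 := dvd_add h1 h2
    rw [pow_succ', Module.End.mul_apply]
    convert h12 using 1
    ring

/-- **Divisibility transfer along the shifts**: `X^J ∣ X^m · X^{m'} · Σ_k ι(C_k(x, y)) X^k` iff
`X^J ∣ Σ_k ι(C_k(T^m x, T^{m'} y)) X^k` — how «all coefficients of `⟨T^{e+a} k₁, T^ε c_y⟩_{A_J}` vanish»
reads as `X^J ∣ X^{e+a} · X^ε · pair k₁ c_y`. [cite: MazurRubin2004, §1.3 and §5.3] -/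
theorem X_pow_dvd_mul_mk_convCoeff_iff (m m' : ℕ) (x : Fin J → M) (y : Fin J → M') :
    (X : R⟦X⟧) ^ J ∣ X ^ m * X ^ m' * PowerSeries.mk (fun k => ι (convCoeff e J k x y)) ↔
      (X : R⟦X⟧) ^ J ∣
        PowerSeries.mk (fun k => ι (convCoeff e J k ((shiftEnd M J ^ m) x) ((shiftEnd M' J ^ m') y))) := by
  have h1 := X_pow_dvd_mk_convCoeff_shiftEnd_pow_left_sub e ι m x ((shiftEnd M' J ^ m') y)
  have h2 := X_pow_dvd_mk_convCoeff_shiftEnd_pow_right_sub e ι m' x y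
  have h3 : (X : R⟦X⟧) ^ J ∣
      PowerSeries.mk (fun k => ι (convCoeff e J k ((shiftEnd M J ^ m) x) ((shiftEnd M' J ^ m') y))) -
        X ^ m * X ^ m' * PowerSeries.mk (fun k => ι (convCoeff e J k x y)) := by
    have := dvd_add h1 (Dvd.dvd.mul_left h2 (X ^ m))
    convert this using 1
    ring
  constructor
  · intro h
    have := dvd_add h3 h
    convert this using 1
    ring
  · intro h
    have := dvd_sub h h3
    convert this using 1
    ring

end GeneratingSeries

/-! ### §4 (appended) From «the family vanishes» + «the `q`-term identity» to the conclusion shape of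
skeleton v5's `stub_stepsTwoFourX9` (`∀ i, i + ε < J → C_i(x₀, c) = 0`) -/

section StubShape

open Literature.NumberTheory.EllipticCurves

variable {M M' P : Type*} [AddCommGroup M] [AddCommGroup M'] [AddCommGroup P] (e : M →+ M' →+ P)
  {J : ℕ}

/-- **`T^m` on the right raises the convolution index by `m`**: `C_{i+m}(x, T^m y) = C_i(x, y)` for
`i + m < J` (k6-ty's `convCoeff_succ_shiftEnd_right`, iterated; the right twin of k6-c2's
`convCoeff_shiftEnd_pow_left_eq`). [cite: MazurRubin2004, §1.3 and §5.3] -/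
theorem convCoeff_add_shiftEnd_pow_right (m : ℕ) {i : ℕ} (hi : i + m < J) (x : Fin J → M)
    (y : Fin J → M') : convCoeff e J (i + m) x ((shiftEnd M' J ^ m) y) = convCoeff e J i x y := by
  induction m generalizing i with
  | zero => simp
  | succ m ih =>
    rw [pow_succ', Module.End.mul_apply, show i + (m + 1) = (i + m) + 1 by omega,
      convCoeff_succ_shiftEnd_right e (by omega), ih (by omega)]

/-- **The packaging of STEP 4 into the stub's conclusion.** Let `ι : P →+ R` be INJECTIVE (a
trivialisation `μ_p ↪ ℤ/p`), `u : ℕ → R` with `u 0` a unit (the unit `u_q(T)` of Lemma 1 (iii)), and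
suppose the coefficient family vanishes after the `q`-term identification:
`Σ_{j ≤ k} u_j · ι(C_{k−j}(x₀, T^ε c)) = 0` for all `k < J` (x10 `…_of_stub_hypotheses` = 0 combined with
koly's identity). Then **`C_i(x₀, c) = 0` for every `i` with `i + ε < J`** — the conclusion shape of
`stub_stepsTwoFourX9` (with `x₀ = aeval S U (S^(e'+1+a) (Φ Fr))` from G3 and `c = Ψc Fr`).
[cite: MazurRubin2004, §4.4] -/
theorem convCoeff_eq_zero_of_family_eq_zero {R : Type*} [CommRing R] (ι : P →+ R)
    (hι : Function.Injective ι) {u : ℕ → R} (hu : IsUnit (u 0)) (ε : ℕ) (x₀ : Fin J → M)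
    (c : Fin J → M')
    (h : ∀ k < J, ∑ j ∈ range (k + 1),
      u j * ι (convCoeff e J (k - j) x₀ ((shiftEnd M' J ^ ε) c)) = 0) :
    ∀ i, i + ε < J → convCoeff e J i x₀ c = 0 := by
  have hall := eq_zero_of_forall_sum_range_mul_eq_zero
    (c := fun k => ι (convCoeff e J k x₀ ((shiftEnd M' J ^ ε) c))) hu h
  intro i hi
  have h1 : ι (convCoeff e J (i + ε) x₀ ((shiftEnd M' J ^ ε) c)) = 0 := hall (i + ε) hi
  rw [convCoeff_add_shiftEnd_pow_right e ε hi] at h1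
  exact hι (by rw [h1, map_zero])

/-- The same with the `q`-term identity and the vanishing given SEPARATELY: a family `Φ : ℕ → R` with
`Φ k = 0` (STEP 4) and `Φ k = Σ_{j ≤ k} u_j · ι(C_{k−j}(x₀, T^ε c))` (Lemma 1 (iii)) for `k < J`.
[cite: MazurRubin2004, §4.4] -/
theorem convCoeff_eq_zero_of_family_eq_zero' {R : Type*} [CommRing R] (ι : P →+ R)
    (hι : Function.Injective ι) {u : ℕ → R} (hu : IsUnit (u 0)) (ε : ℕ) (x₀ : Fin J → M)
    (c : Fin J → M') (Φ : ℕ → R) (hvan : ∀ k < J, Φ k = 0)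
    (hid : ∀ k < J, Φ k = ∑ j ∈ range (k + 1),
      u j * ι (convCoeff e J (k - j) x₀ ((shiftEnd M' J ^ ε) c))) :
    ∀ i, i + ε < J → convCoeff e J i x₀ c = 0 :=
  convCoeff_eq_zero_of_family_eq_zero e ι hι hu ε x₀ c fun k hk => by rw [← hid k hk, hvan k hk]

end StubShape

end Summit.BirchSwinnertonDyer.BirchSwinnertonDyer.Rank1Residual.StepFour
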